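import Literature.MathematicalPhysics.QuantumLattice.SymmetricCertificateResidual
import HarnessLib

/-!
# Bootstrap certificates for a LOCAL objective in the tracial sector ground state
# (the finite-volume form of a translation-invariant / thermodynamic-limit certificate)

Family `hubbard` (topic `MathematicalPhysics/QuantumLattice`). Companion to
`Matrix.minEnergyOn_ge_of_symmetric_certificate_residual` (SymmetricCertificateResidual). A
thermodynamic-limit ("reduce"-mode) bootstrap certificate (X. Han, arXiv:2006.06002 (2020) §2–3:
the functional is translation invariant, `F[U⁻¹ O U] = F[O]`, stationary, `F[[H,O]] = 0`, and the
objective is the energy PER SITE `h`, `Σ_x τ_x h = H`; certificate format `certsdp/1` §3 mode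
`reduce` of the bundle papers/HubbardSuperconductivity/manybody-bootstrap/) is an identity for a
LOCAL objective `X` rather than for the Hamiltonian `A` itself:

  `X − c·1 = Σᵢⱼ Λᵢⱼ Oᵢᴴ Oⱼ + (Σₖ [A, Xₖ] + Σₗ (Uₗ Yₗ Uₗᴴ − Yₗ) + Σᵣ (Zᵣ (Qᵣ − qᵣ) + (Qᵣ − qᵣ) Z'ᵣ)
              + Σⱼ (Cⱼ Wⱼ − Wⱼ Cⱼ)) + (Σₘ dₘ • (Vₘᴴ − Vₘ) + Σₖ aₖ • Mₖ)`.

Evaluated in the tracial ground state `ω_P = tr(P ·)/tr P` of a sector `K` of a finite volume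
(`P` = the projection onto the sector ground multiplet, `Matrix.sectorGroundProj`; SectorGroundState),
every bracket vanishes or has vanishing real part — commutators with `A` (stationarity), symmetry
defects for unitaries `Uₗ` commuting with `A` and preserving `K` (translation / point-group
invariance), the sector ideal, commutators with conserved CHARGES `Cⱼ` commuting with `A` and
preserving `K` (gauge invariance: charged monomials have zero expectation), and anti-Hermitian parts
`dₘ (Vᴴ − V)` with real `dₘ` (identification of a monomial with its adjoint; `Re ω(Vᴴ) = Re ω(V)`)
— while each residual contraction `Mₖ` costs at most `‖aₖ‖`. Hence
`c − Σₖ ‖aₖ‖ ≤ Re ω_P(X)` (`Matrix.re_projState_ge_of_local_certificate`). If moreover the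
translates of `X` under a finite family of such symmetries `T_v` sum to the Hamiltonian,
`Σ_v T_v X T_vᴴ = A` (periodic boundary conditions: Bratteli–Robinson II §6.2.4), then
`ω_P(X) = minEnergyOn A K / #V` (`Matrix.projState_eq_div_of_sum_conj`) and the certificate bounds
the sector ground energy PER TRANSLATE: `(c − Σₖ ‖aₖ‖) · #V ≤ minEnergyOn A K`
(`Matrix.mul_card_le_minEnergyOn_of_local_certificate`). Everything is PROVED; no definition, no
named fact.

## References
* X. Han, *Quantum many-body bootstrap*, arXiv:2006.06002 (2020), §2 eq. (2)–(3), §3.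
  [cite: Han2020Bootstrap, §2 eq. (2)–(3)]
* I. Kull, N. Schuch, B. Dive, M. Navascués, PRX 14 (2024) 021008, §5.3 (rounded certificates).
  [cite: KullEtAl2024, §5.3]
* O. Bratteli, D. W. Robinson, *Operator Algebras and Quantum Statistical Mechanics II*, 2nd ed.,
  §6.2.4 (periodic states, mean energy per site). [cite: BratteliRobinsonII1997, §6.2.4]
* H. Tasaki, *Physics and Mathematics of Quantum Many-Body Systems* (2020), §2.1–2.2.
  [cite: Tasaki2020, §2.2]
-/

noncomputable section

open Literature.MathematicalPhysics.QuantumLattice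
open Literature.MathematicalPhysics.QuantumManyBody.StateRelaxation
open scoped ComplexOrder BigOperators

namespace Matrix

variable {n : Type*} [Fintype n] [DecidableEq n]

/-! ### More null terms of the tracial state of a projection -/

/-- `ω_P(Xᴴ) = conj ω_P(X)` for Hermitian `P`. [folklore] -/
theorem projState_conjTranspose {P : Matrix n n ℂ} (hP : P.IsHermitian) (X : Matrix n n ℂ) :
    P.projState Xᴴ = star (P.projState X) := by
  rw [projState_apply, projState_apply, star_mul', star_inv₀, ← trace_conjTranspose,
    ← trace_conjTranspose, conjTranspose_mul, hP.eq, trace_mul_comm]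

/-- Anti-Hermitian parts have purely imaginary expectation: `Re ω_P(Xᴴ − X) = 0`. [folklore] -/
theorem projState_re_conjTranspose_sub {P : Matrix n n ℂ} (hP : P.IsHermitian) (X : Matrix n n ℂ) :
    (P.projState (Xᴴ - X)).re = 0 := by
  rw [map_sub, projState_conjTranspose hP, Complex.sub_re, Complex.star_def, Complex.conj_re,
    sub_self]

/-- With a REAL coefficient: `Re ω_P(d • (Xᴴ − X)) = 0`. [folklore] -/
theorem projState_re_real_smul_conjTranspose_sub {P : Matrix n n ℂ} (hP : P.IsHermitian) (d : ℝ)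
    (X : Matrix n n ℂ) : (P.projState ((d : ℂ) • (Xᴴ - X))).re = 0 := by
  rw [map_smul, smul_eq_mul, Complex.re_ofReal_mul, projState_re_conjTranspose_sub hP, mul_zero]

/-- **Gauge invariance of the tracial state**: an operator commuting with `P` kills commutators,
`P C = C P ⇒ ω_P(C W − W C) = 0` (cyclicity of the trace); with `C` a conserved charge this says
that CHARGED operators (`C W − W C = q W`, `q ≠ 0`) have zero expectation. Han 2020 §2
("`⟨O⟩ = 0` unless `O` commutes with the conserved charges"). [cite: Han2020Bootstrap, §2] -/
theorem projState_commutator_of_commute {P C : Matrix n n ℂ} (hPC : P * C = C * P)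
    (W : Matrix n n ℂ) : P.projState (C * W - W * C) = 0 := by
  have h1 : (P * (C * W)).trace = (C * P * W).trace := by rw [← Matrix.mul_assoc, hPC]
  have h2 : (P * (W * C)).trace = (C * P * W).trace := by
    rw [← Matrix.mul_assoc, trace_mul_cycle, Matrix.mul_assoc]
  rw [projState_apply, Matrix.mul_sub, trace_sub, h1, h2, sub_self, mul_zero]

/-- Charged operators have zero expectation: `P C = C P`, `C W − W C = q • W`, `q ≠ 0` ⇒
`ω_P(W) = 0`. [cite: Han2020Bootstrap, §2] -/
theorem projState_eq_zero_of_charge {P C W : Matrix n n ℂ} (hPC : P * C = C * P) {q : ℂ}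
    (hq : q ≠ 0) (hW : C * W - W * C = q • W) : P.projState W = 0 := by
  have h := projState_commutator_of_commute hPC W
  rw [hW, map_smul, smul_eq_mul] at h
  exact (mul_eq_zero.mp h).resolve_left hq

/-- **Averaging over a symmetry group**: if every `T_v` commutes with `P` and `T_vᴴ T_v = 1`, then
`ω_P(Σ_v T_v X T_vᴴ) = #V · ω_P(X)`. Bratteli–Robinson II §6.2.4 (periodic states).
[cite: BratteliRobinsonII1997, §6.2.4] -/
theorem projState_sum_conj {P : Matrix n n ℂ} {V : Type*} [Fintype V] (T : V → Matrix n n ℂ)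
    (hPT : ∀ v, P * T v = T v * P) (hTT : ∀ v, (T v)ᴴ * T v = 1) (X : Matrix n n ℂ) :
    P.projState (∑ v, T v * X * (T v)ᴴ) = (Fintype.card V : ℂ) * P.projState X := by
  rw [map_sum, Finset.sum_congr rfl fun v _ => projState_conj (hPT v) (hTT v) X, Finset.sum_const,
    Finset.card_univ, nsmul_eq_mul]

/-- **The expectation of a local energy is the energy per translate**: if `P A = e P`, `P` is a
nonzero Hermitian idempotent, and the translates of `X` under symmetries `T_v` commuting with `P`
sum to `A`, `Σ_v T_v X T_vᴴ = A`, then `ω_P(X) = e / #V`. [cite: BratteliRobinsonII1997, §6.2.4] -/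
theorem projState_eq_div_of_sum_conj {P A : Matrix n n ℂ} (hP : P.IsHermitian) (hP2 : P * P = P)
    (hP0 : P ≠ 0) {e : ℂ} (hPA : P * A = e • P) {V : Type*} [Fintype V] [Nonempty V]
    (T : V → Matrix n n ℂ) (hPT : ∀ v, P * T v = T v * P) (hTT : ∀ v, (T v)ᴴ * T v = 1)
    {X : Matrix n n ℂ} (hsum : ∑ v, T v * X * (T v)ᴴ = A) :
    P.projState X = e / (Fintype.card V : ℂ) := by
  have h := projState_sum_conj T hPT hTT X
  rw [hsum, projState_self hP hP2 hP0 hPA] at h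
  have hV : (Fintype.card V : ℂ) ≠ 0 := Nat.cast_ne_zero.mpr Fintype.card_ne_zero
  rw [h, mul_div_cancel_left₀ _ hV]

/-! ### The certificate for a local objective -/

/-- **Local-objective certificate in the tracial sector ground state.** Let `A` be Hermitian, `K ≠ ⊥`
an `A`-invariant sector, `P` the sector ground projection and `ω_P` its tracial state. An identity
`X − c·1 = Σᵢⱼ Λᵢⱼ Oᵢᴴ Oⱼ + (Σₖ (A Xₖ − Xₖ A) + Σₗ (Uₗ Yₗ Uₗᴴ − Yₗ) + Σᵣ (Zᵣ (Qᵣ − qᵣ) + (Qᵣ − qᵣ) Z'ᵣ)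
  + Σⱼ (Cⱼ Wⱼ − Wⱼ Cⱼ)) + (Σₘ dₘ • (Vₘᴴ − Vₘ) + Σₖ aₖ • Mₖ)`
with `Λ ⪰ 0`; symmetries `Uₗ` and charges `Cⱼ` commuting with `A` and, together with their
adjoints, preserving `K` (`Uₗᴴ Uₗ = 1`); Hermitian `Qᵣ` acting as the real scalar `qᵣ` on `K`; real
`dₘ`; contractions `Mₖ` — proves `c − Σₖ ‖aₖ‖ ≤ Re ω_P(X)`. Han 2020 §2 eq. (2)–(3) (all
constraint classes: positivity, stationarity, symmetry, conserved charges) with KSDN 2024 §5.3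
rounding, for an arbitrary objective. [cite: Han2020Bootstrap, §2 eq. (2)–(3)] -/
theorem re_projState_ge_of_local_certificate {A : Matrix n n ℂ} (hA : A.IsHermitian)
    (K : Submodule ℂ (n → ℂ)) (hKA : ∀ v ∈ K, A *ᵥ v ∈ K) (hK : K ≠ ⊥)
    (X : Matrix n n ℂ)
    {m : Type*} [Fintype m] [DecidableEq m] {Λ : Matrix m m ℂ} (hΛ : Λ.PosSemidef)
    (O : m → Matrix n n ℂ)
    {κ : Type*} (s : Finset κ) (Xc : κ → Matrix n n ℂ)
    {ι : Type*} (t : Finset ι) (U Y : ι → Matrix n n ℂ) (hU : ∀ l ∈ t, U l * A = A * U l)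
    (hUK : ∀ l ∈ t, ∀ v ∈ K, U l *ᵥ v ∈ K) (hUK' : ∀ l ∈ t, ∀ v ∈ K, (U l)ᴴ *ᵥ v ∈ K)
    (hUU : ∀ l ∈ t, (U l)ᴴ * U l = 1)
    {ρ : Type*} (r : Finset ρ) (Q Z Z' : ρ → Matrix n n ℂ) (q : ρ → ℝ)
    (hQh : ∀ i ∈ r, (Q i).IsHermitian) (hQ : ∀ i ∈ r, ∀ v ∈ K, Q i *ᵥ v = ((q i : ℝ) : ℂ) • v)
    {γ : Type*} (u : Finset γ) (C W : γ → Matrix n n ℂ) (hC : ∀ j ∈ u, C j * A = A * C j)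
    (hCK : ∀ j ∈ u, ∀ v ∈ K, C j *ᵥ v ∈ K) (hCK' : ∀ j ∈ u, ∀ v ∈ K, (C j)ᴴ *ᵥ v ∈ K)
    {δ : Type*} (ah : Finset δ) (dc : δ → ℝ) (V : δ → Matrix n n ℂ)
    {κ'' : Type*} (w : Finset κ'') (a : κ'' → ℂ) (M : κ'' → Matrix n n ℂ)
    (hM : ∀ k ∈ w, (M k).IsContraction) {c : ℝ}
    (hcert : X - (c : ℂ) • (1 : Matrix n n ℂ) =
      gramForm Λ O +
        (∑ k ∈ s, (A * Xc k - Xc k * A) + ∑ l ∈ t, (U l * Y l * (U l)ᴴ - Y l) +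
          ∑ i ∈ r, (Z i * (Q i - ((q i : ℝ) : ℂ) • 1) + (Q i - ((q i : ℝ) : ℂ) • 1) * Z' i) +
          ∑ j ∈ u, (C j * W j - W j * C j)) +
        (∑ m' ∈ ah, ((dc m' : ℝ) : ℂ) • ((V m')ᴴ - V m') + ∑ k ∈ w, a k • M k)) :
    c - ∑ k ∈ w, ‖a k‖ ≤ ((A.sectorGroundProj K).projState X).re := by
  set P := A.sectorGroundProj K with hP
  set e : ℂ := ((A.minEnergyOn K : ℝ) : ℂ) with he
  have hPh : P.IsHermitian := sectorGroundProj_isHermitian A K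
  have hP2 : P * P = P := sectorGroundProj_mul_self A K
  have hP0 : P ≠ 0 := sectorGroundProj_ne_zero hA K hKA hK
  have hAP : A * P = e • P := mul_sectorGroundProj A K
  have hPA : P * A = e • P := sectorGroundProj_mul hA K
  set ω := P.projState with hω
  have hpos : ∀ x : Matrix n n ℂ, 0 ≤ ω (star x * x) := fun x => by
    rw [hω, star_eq_conjTranspose]; exact projState_nonneg hPh hP2 x
  have hone : ω 1 = 1 := projState_one hPh hP2 hP0
  have hnull : ω (∑ k ∈ s, (A * Xc k - Xc k * A) + ∑ l ∈ t, (U l * Y l * (U l)ᴴ - Y l) +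
      ∑ i ∈ r, (Z i * (Q i - ((q i : ℝ) : ℂ) • 1) + (Q i - ((q i : ℝ) : ℂ) • 1) * Z' i) +
      ∑ j ∈ u, (C j * W j - W j * C j)) = 0 := by
    rw [map_add, map_add, map_add, map_sum, map_sum, map_sum, map_sum]
    have h1 : ∀ k ∈ s, ω (A * Xc k - Xc k * A) = 0 := fun k _ => projState_commutator hAP hPA _
    have h2 : ∀ l ∈ t, ω (U l * Y l * (U l)ᴴ - Y l) = 0 := fun l hl => by
      rw [map_sub, hω, projState_conj (sectorGroundProj_commute hA K (hU l hl) (hUK l hl) (hUK' l hl))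
        (hUU l hl), sub_self]
    have h3 : ∀ i ∈ r, ω (Z i * (Q i - ((q i : ℝ) : ℂ) • 1) + (Q i - ((q i : ℝ) : ℂ) • 1) * Z' i) = 0 :=
      fun i hi => by
        rw [map_add, hω, projState_mul_of_mul_eq_zero (sub_smul_mul_sectorGroundProj A K (hQ i hi)),
          projState_mul_of_mul_eq_zero' (sectorGroundProj_mul_sub_smul A K (hQh i hi) (hQ i hi)),
          add_zero]
    have h4 : ∀ j ∈ u, ω (C j * W j - W j * C j) = 0 := fun j hj =>
      projState_commutator_of_commute (sectorGroundProj_commute hA K (hC j hj) (hCK j hj) (hCK' j hj)) _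
    rw [Finset.sum_eq_zero h1, Finset.sum_eq_zero h2, Finset.sum_eq_zero h3, Finset.sum_eq_zero h4,
      add_zero, add_zero, add_zero]
  have hres : -(∑ k ∈ w, ‖a k‖) ≤
      (ω (∑ m' ∈ ah, ((dc m' : ℝ) : ℂ) • ((V m')ᴴ - V m') + ∑ k ∈ w, a k • M k)).re := by
    have hah : (ω (∑ m' ∈ ah, ((dc m' : ℝ) : ℂ) • ((V m')ᴴ - V m'))).re = 0 := by
      rw [map_sum, Complex.re_sum]
      exact Finset.sum_eq_zero fun m' _ => projState_re_real_smul_conjTranspose_sub hPh (dc m') (V m')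
    have hr : -(∑ k ∈ w, ‖a k‖) ≤ (ω (∑ k ∈ w, a k • M k)).re :=
      neg_sum_norm_le_re_map_sum w ω a M fun k hk => by
        rw [hω]; exact sectorGroundProj_re_mul_projState_ge hA K hKA hK (hM k hk) (a k)
    rw [map_add, Complex.add_re, hah, zero_add]
    exact hr
  exact le_re_map_of_certificate_residual ω hpos hone hΛ O hnull hres hcert

/-- **Local-objective certificate ⇒ ground energy per translate.** Under the hypotheses of
`Matrix.re_projState_ge_of_local_certificate`, if the translates of the objective under a finite
nonempty family of symmetries `T_v` (commuting with `A`; `T_v`, `T_vᴴ` preserving `K`; `T_vᴴ T_v = 1`)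
sum to the Hamiltonian, `Σ_v T_v X T_vᴴ = A`, then `(c − Σₖ ‖aₖ‖) · #V ≤ minEnergyOn A K`.
This is the finite-volume (periodic-box) soundness of a translation-invariant bootstrap
certificate for the energy per site: Han 2020 §2–3; Bratteli–Robinson II §6.2.4.
[cite: Han2020Bootstrap, §3] -/
theorem mul_card_le_minEnergyOn_of_local_certificate {A : Matrix n n ℂ} (hA : A.IsHermitian)
    (K : Submodule ℂ (n → ℂ)) (hKA : ∀ v ∈ K, A *ᵥ v ∈ K) (hK : K ≠ ⊥)
    (X : Matrix n n ℂ)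
    {V' : Type*} [Fintype V'] [Nonempty V'] (T : V' → Matrix n n ℂ)
    (hT : ∀ v, T v * A = A * T v) (hTK : ∀ v, ∀ ψ ∈ K, T v *ᵥ ψ ∈ K)
    (hTK' : ∀ v, ∀ ψ ∈ K, (T v)ᴴ *ᵥ ψ ∈ K) (hTT : ∀ v, (T v)ᴴ * T v = 1)
    (hsum : ∑ v, T v * X * (T v)ᴴ = A)
    {m : Type*} [Fintype m] [DecidableEq m] {Λ : Matrix m m ℂ} (hΛ : Λ.PosSemidef)
    (O : m → Matrix n n ℂ)
    {κ : Type*} (s : Finset κ) (Xc : κ → Matrix n n ℂ)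
    {ι : Type*} (t : Finset ι) (U Y : ι → Matrix n n ℂ) (hU : ∀ l ∈ t, U l * A = A * U l)
    (hUK : ∀ l ∈ t, ∀ v ∈ K, U l *ᵥ v ∈ K) (hUK' : ∀ l ∈ t, ∀ v ∈ K, (U l)ᴴ *ᵥ v ∈ K)
    (hUU : ∀ l ∈ t, (U l)ᴴ * U l = 1)
    {ρ : Type*} (r : Finset ρ) (Q Z Z' : ρ → Matrix n n ℂ) (q : ρ → ℝ)
    (hQh : ∀ i ∈ r, (Q i).IsHermitian) (hQ : ∀ i ∈ r, ∀ v ∈ K, Q i *ᵥ v = ((q i : ℝ) : ℂ) • v)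
    {γ : Type*} (u : Finset γ) (C W : γ → Matrix n n ℂ) (hC : ∀ j ∈ u, C j * A = A * C j)
    (hCK : ∀ j ∈ u, ∀ v ∈ K, C j *ᵥ v ∈ K) (hCK' : ∀ j ∈ u, ∀ v ∈ K, (C j)ᴴ *ᵥ v ∈ K)
    {δ : Type*} (ah : Finset δ) (dc : δ → ℝ) (V : δ → Matrix n n ℂ)
    {κ'' : Type*} (w : Finset κ'') (a : κ'' → ℂ) (M : κ'' → Matrix n n ℂ)
    (hM : ∀ k ∈ w, (M k).IsContraction) {c : ℝ}
    (hcert : X - (c : ℂ) • (1 : Matrix n n ℂ) =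
      gramForm Λ O +
        (∑ k ∈ s, (A * Xc k - Xc k * A) + ∑ l ∈ t, (U l * Y l * (U l)ᴴ - Y l) +
          ∑ i ∈ r, (Z i * (Q i - ((q i : ℝ) : ℂ) • 1) + (Q i - ((q i : ℝ) : ℂ) • 1) * Z' i) +
          ∑ j ∈ u, (C j * W j - W j * C j)) +
        (∑ m' ∈ ah, ((dc m' : ℝ) : ℂ) • ((V m')ᴴ - V m') + ∑ k ∈ w, a k • M k)) :
    (c - ∑ k ∈ w, ‖a k‖) * Fintype.card V' ≤ A.minEnergyOn K := by
  have h := re_projState_ge_of_local_certificate hA K hKA hK X hΛ O s Xc t U Y hU hUK hUK' hUU r Q Z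
    Z' q hQh hQ u C W hC hCK hCK' ah dc V w a M hM hcert
  set P := A.sectorGroundProj K with hP
  have hPh : P.IsHermitian := sectorGroundProj_isHermitian A K
  have hP2 : P * P = P := sectorGroundProj_mul_self A K
  have hP0 : P ≠ 0 := sectorGroundProj_ne_zero hA K hKA hK
  have hPA : P * A = ((A.minEnergyOn K : ℝ) : ℂ) • P := sectorGroundProj_mul hA K
  have hPT : ∀ v, P * T v = T v * P := fun v =>
    sectorGroundProj_commute hA K (hT v) (hTK v) (hTK' v)
  have hX : P.projState X = ((A.minEnergyOn K : ℝ) : ℂ) / (Fintype.card V' : ℂ) :=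
    projState_eq_div_of_sum_conj hPh hP2 hP0 hPA T hPT hTT hsum
  have hre : (P.projState X).re = A.minEnergyOn K / (Fintype.card V' : ℝ) := by
    rw [hX, ← Complex.ofReal_natCast, ← Complex.ofReal_div, Complex.ofReal_re]
  rw [hre] at h
  have hV : (0 : ℝ) < Fintype.card V' := by exact_mod_cast Fintype.card_pos
  exact (le_div_iff₀ hV).mp h

end Matrix
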